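import Literature.AlgebraicTopology.KTheory.Collapse
import Literature.AlgebraicTopology.KTheory.HomotopyInvariance
import Literature.AlgebraicTopology.KTheory.QuotientContractible
import Literature.AlgebraicTopology.KTheory.ReducedSphereVanishing
import HarnessLib

/-!
# Homotopies of maps of pairs descend to the collapsed spaces; `K̃(X/A) ≅ K̃(X)` for contractible `A`

General tools for the Hopf-invariant-one argument (Hatcher, *VBKT* §2.3):

* §1 **descent of homotopies**: a homotopy `H` of maps of pairs `(X, A) → (Y, B)`
  (`H_t(A) ⊆ B` for all `t`) induces a homotopy `I × X/A → Y/B` of the induced maps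
  (`Collapse.mapHomotopy`; continuity through the closed quotient map `I × (X ⊕ pt) → I × X/A`),
  hence **equal pull-backs `(f/A)^* = (g/A)^*` on `K⁰`** (`pullback_map_eq_of_homotopy`);
* §2 maps of pairs that agree as maps induce the same map (`Collapse.map_congr`), transport of
  the collapse along an equality of closed sets (`Collapse.castHomeo`);
* §3 the **reduced** isomorphism `K̃(X/A) ≅ K̃(X, a₀)` for `A` contractible, `a₀ ∈ A`
  (`reducedQuotKEquiv`).

## References

* A. Hatcher, *Vector Bundles and K-Theory* (v2.2, 2017), §2.1 (p. 52), §2.3 proof of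
  Lemma 2.18. [HatcherVBKT2017]
* A. Hatcher, *Algebraic Topology* (2002), Ch. 0, Prop. 0.17. [HatcherAT2002]
-/

noncomputable section

open Set Topology TopologicalSpace unitInterval

namespace Literature.AlgebraicTopology.KTheory

universe u v

namespace Collapse

variable {X : Type u} [TopologicalSpace X] {A : Closeds X}
variable {Y : Type v} [TopologicalSpace Y] {B : Closeds Y}

/-! ### 1. Descent of homotopies -/

/-- The quotient map `I × (X ⊕ pt) → I × X/A`. [folklore] -/
def prodMk' (A : Closeds X) : C(I × (X ⊕ Unit), I × Collapse X A) :=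
  (ContinuousMap.id I).prodMap ⟨mk' A, continuous_mk'⟩

/-- Homotopies of pairs descend (Hatcher AT Prop. 0.17). [folklore] -/
theorem prodMk'_surjective : Function.Surjective (prodMk' A) := fun ⟨t, z⟩ ↦ by
  obtain ⟨w, rfl⟩ := mk'_surjective z
  exact ⟨(t, w), rfl⟩

/-- For compact Hausdorff `X`, `I × (X ⊕ pt) → I × X/A` is a quotient map (a closed continuous
surjection). [folklore] -/
theorem isQuotientMap_prodMk' [CompactSpace X] [T2Space X] [RegularSpace X] : IsQuotientMap (prodMk' A) :=
  (prodMk' A).continuous.isClosedMap.isQuotientMap (prodMk' A).continuous prodMk'_surjective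

/-- The slices `H_t` of a homotopy as maps of pairs. [folklore] -/
def sliceMap (H : C(I × X, Y)) (hH : ∀ t, MapsTo (fun x ↦ H (t, x)) A B) (t : I) : C(Collapse X A, Collapse Y B) :=
  map (H.curry t) (hH t)

/-- **Descent of a homotopy of pairs**: `(t, [x]) ↦ [H(t, x)]`, `(t, pt) ↦ pt`, is continuous on
`I × X/A`. [cite: HatcherAT2002, Ch. 0 Prop. 0.17] -/
def mapHomotopy [CompactSpace X] [T2Space X] [RegularSpace X] (H : C(I × X, Y)) (hH : ∀ t, MapsTo (fun x ↦ H (t, x)) A B) :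
    C(I × Collapse X A, Collapse Y B) where
  toFun p := sliceMap H hH p.1 p.2
  continuous_toFun := by
    rw [isQuotientMap_prodMk'.continuous_iff]
    have h : (fun p : I × Collapse X A ↦ sliceMap H hH p.1 p.2) ∘ prodMk' A =
        Sum.elim (fun q : I × X ↦ mk B (H q)) (fun _ : I × Unit ↦ pt B) ∘ Homeomorph.prodSumDistrib := by
      funext ⟨t, z⟩
      rcases z with x | u <;> rfl
    rw [h]
    exact (((mk B).continuous.comp H.continuous).sumElim continuous_const).comp (Homeomorph.prodSumDistrib).continuous

/-- Homotopies of pairs descend (Hatcher AT Prop. 0.17). [folklore] -/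
@[simp] theorem mapHomotopy_mk [CompactSpace X] [T2Space X] [RegularSpace X] (H : C(I × X, Y)) (hH) (t : I) (x : X) :
    mapHomotopy H hH (t, mk A x) = mk B (H (t, x)) := rfl

/-- Homotopies of pairs descend (Hatcher AT Prop. 0.17). [folklore] -/
@[simp] theorem mapHomotopy_pt [CompactSpace X] [T2Space X] [RegularSpace X] (H : C(I × X, Y)) (hH) (t : I) :
    mapHomotopy H hH (t, pt A) = pt B := rfl

/-- **Homotopic maps of pairs induce homotopic maps of collapsed spaces.** [cite: HatcherAT2002, Ch. 0 Prop. 0.17] -/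
def homotopyMap [CompactSpace X] [T2Space X] [RegularSpace X] {f g : C(X, Y)} (hf : MapsTo f A B) (hg : MapsTo g A B)
    (H : f.Homotopy g) (hH : ∀ t, MapsTo (fun x ↦ H (t, x)) A B) : (map f hf).Homotopy (map g hg) where
  toFun := mapHomotopy (H : C(I × X, Y)) hH
  continuous_toFun := (mapHomotopy (H : C(I × X, Y)) hH).continuous
  map_zero_left z := by
    rcases eq_pt_or_eq_mk z with rfl | ⟨x, -, rfl⟩
    · rfl
    · change mk B (H (0, x)) = mk B (f x); rw [H.apply_zero]
  map_one_left z := by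
    rcases eq_pt_or_eq_mk z with rfl | ⟨x, -, rfl⟩
    · rfl
    · change mk B (H (1, x)) = mk B (g x); rw [H.apply_one]

/-- **Homotopic maps of pairs induce the same map `K⁰(Y/B) → K⁰(X/A)`.** [cite: HatcherVBKT2017, §2.3 proof of Lemma 2.18] -/
theorem pullback_map_eq_of_homotopy [CompactSpace X] [T2Space X] [RegularSpace X] {f g : C(X, Y)} (hf : MapsTo f A B) (hg : MapsTo g A B)
    (H : f.Homotopy g) (hH : ∀ t, MapsTo (fun x ↦ H (t, x)) A B) : pullback (map f hf) = pullback (map g hg) :=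
  pullback_eq_of_homotopic ⟨homotopyMap hf hg H hH⟩

/-! ### 2. Congruence and transport -/

/-- Maps of pairs with the same underlying map induce the same map. [folklore] -/
theorem map_congr {f g : C(X, Y)} (hf : MapsTo f A B) (hg : MapsTo g A B) (h : f = g) : map f hf = map g hg := by
  subst h; rfl

/-- Transport of `X/A` along an equality of closed sets. [folklore] -/
def castHomeo {A A' : Closeds X} (h : A = A') : Collapse X A ≃ₜ Collapse X A' := h ▸ Homeomorph.refl _

/-- Homotopies of pairs descend (Hatcher AT Prop. 0.17). [folklore] -/
theorem castHomeo_mk {A A' : Closeds X} (h : A = A') (x : X) : castHomeo h (mk A x) = mk A' x := by subst h; rfl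

/-- Homotopies of pairs descend (Hatcher AT Prop. 0.17). [folklore] -/
theorem castHomeo_pt {A A' : Closeds X} (h : A = A') : castHomeo h (pt A) = pt A' := by subst h; rfl

/-- Homotopies of pairs descend (Hatcher AT Prop. 0.17). [folklore] -/
theorem coe_castHomeo_eq_map {A A' : Closeds X} (h : A = A') :
    ((castHomeo h : Collapse X A ≃ₜ Collapse X A') : C(Collapse X A, Collapse X A')) = map (ContinuousMap.id X) (by rw [h]; exact mapsTo_id _) := by
  subst h
  exact hom_ext (fun _ ↦ rfl) rfl

end Collapse

/-! ### 3. The reduced isomorphism `K̃(X/A) ≅ K̃(X)` for contractible `A` -/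

section ReducedQuot

variable {X : Type u} [TopologicalSpace X] [CompactSpace X] [T2Space X] {A : Closeds X}

/-- **`K̃(X/A) ≅ K̃(X, a₀)` for `A` closed contractible and `a₀ ∈ A`** (restriction of
`quotKEquiv`). [cite: HatcherVBKT2017, §2.1 p. 52] -/
def reducedQuotKEquiv (A : Closeds X) [ContractibleSpace (A : Set X)] {a₀ : X} (ha₀ : a₀ ∈ A) :
    Reduced (Collapse X A) (Collapse.pt A) ≃+ Reduced X a₀ where
  toFun b := ⟨quotK A b, (quotK_mem_reduced_iff ha₀ _).2 b.2⟩
  invFun a := ⟨(quotKEquiv A).symm a, by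
    rw [← quotK_mem_reduced_iff ha₀, ← quotKEquiv_apply, AddEquiv.apply_symm_apply]; exact a.2⟩
  left_inv b := Subtype.ext ((quotKEquiv A).symm_apply_apply (b : K0 (Collapse X A)))
  right_inv a := Subtype.ext ((quotKEquiv A).apply_symm_apply (a : K0 X))
  map_add' b b' := Subtype.ext (map_add (quotK A) _ _)

/-- Auxiliary statement for `K̃(X/A) ≅ K̃(X)`. [folklore] -/
@[simp] theorem coe_reducedQuotKEquiv (A : Closeds X) [ContractibleSpace (A : Set X)] {a₀ : X} (ha₀ : a₀ ∈ A)
    (b : Reduced (Collapse X A) (Collapse.pt A)) : (reducedQuotKEquiv A ha₀ b : K0 X) = quotK A b := rfl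

/-- Every reduced class of `X` (based in `A`) lifts uniquely to `X/A`. [cite: HatcherVBKT2017, §2.1 p. 52] -/
theorem exists_unique_reduced_lift (A : Closeds X) [ContractibleSpace (A : Set X)] {a₀ : X} (ha₀ : a₀ ∈ A) (a : Reduced X a₀) :
    ∃! b : Reduced (Collapse X A) (Collapse.pt A), quotK A b = a :=
  ⟨(reducedQuotKEquiv A ha₀).symm a, congrArg Subtype.val ((reducedQuotKEquiv A ha₀).apply_symm_apply a), fun b hb ↦ by
    apply (reducedQuotKEquiv A ha₀).injective
    rw [AddEquiv.apply_symm_apply]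
    exact Subtype.ext hb⟩

end ReducedQuot

end Literature.AlgebraicTopology.KTheory

end
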